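import Summits.AtomisticToContinuum.Crystallization.Theorems.FrustratedLawDichotomyStrainedPatchHomLatticeBoxWindow

/-!
# Bounded quantifiers over the displacement sets reduce to label boxes
# (27623 strained-patch piece; decomp-a2c, prover hand 2, generation 20 — glue for the prune / witness certificates)

Every certificate hypothesis of `…HomPrunesFit`, `…HomPrunesSpread`, `…HomWitnessSite` quantifies over the displacement set with a norm bound:
`∀ w ∈ T, (w ≠ 0 →) ‖w‖ < R → P w` (or `‖w‖ ≤ D`).  Under `‖U − 1‖ ≤ 1/4` such a quantifier is a FINITE conjunction over a label box.  DEF-FREE: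

* `forall_fcc_of_forall_box` — `T = U·L_fcc`: from `∀ b ∈ [−K,K]³, ‖latPt U fccVec b‖ < R → P (latPt U fccVec b)` with `8R² < 3(K+1)²`;
* `forall_hcpA_of_forall_boxes` — `T_A = U·L_hex ∪ (U·L_hex + U(hcpShift + ξ))` (`‖ξ‖ ≤ 1/4`): two label boxes, conditions
  `64R² < 27(K+1)²` and `16(4R/3 + 1/4)² < 3(2K+1)²` (as in `finsum_hcp_eq_boxSum`); `forall_hcpB_of_forall_hcpA_neg` — `T_B = −T_A`;
* the `≤`-bounded forms follow by `lt_of_le_of_lt` (take any `R` above the bound).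

0 sorry; no definitions; axioms ⊆ {propext, Classical.choice, Quot.sound}.  `--supports stmt-AtomisticToContinuum-27623`.
-/

noncomputable section

namespace Summit.AtomisticToContinuum.Crystallization.Theorems.FrustratedLawDichotomyStrainedPatchHomBoxForall

open scoped BigOperators Classical
open Summit.AtomisticToContinuum.Crystallization.Theorems.ChargedEnergyGapNegative (E3)
open Summit.AtomisticToContinuum.Crystallization.Theorems.FrustratedLawDichotomyStrainedPatchHomSplit
open Summit.AtomisticToContinuum.Crystallization.Theorems.FrustratedLawDichotomyStrainedPatchHomLattice
open Summit.AtomisticToContinuum.Crystallization.Theorems.FrustratedLawDichotomyStrainedPatchHomRelief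
open Summit.AtomisticToContinuum.Crystallization.Theorems.FrustratedLawDichotomyStrainedPatchHomLatticeBox
open Summit.AtomisticToContinuum.Crystallization.Theorems.FrustratedLawDichotomyStrainedPatchHomLatticeBoxHcp
open Summit.AtomisticToContinuum.Crystallization.Theorems.FrustratedLawDichotomyStrainedPatchHomLatticeBoxWindow
open Literature.Barriers.AtomisticToContinuum.FlatleyTheil2015 (fccVec fccPoint)

/-- ★ **fcc: a norm-bounded quantifier over `U·L_fcc` is a box conjunction** (`‖U − 1‖ ≤ 1/4`, `8R² < 3(K+1)²`). [folklore] -/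
theorem forall_fcc_of_forall_box {U : E3 →L[ℝ] E3} (hU : ‖U - 1‖ ≤ 1 / 4) {R : ℝ} {K : ℕ} (hK : 8 * R ^ 2 < 3 * ((K : ℝ) + 1) ^ 2)
    {P : E3 → Prop}
    (h : ∀ b ∈ (Fintype.piFinset fun _ : Fin 3 => Finset.Icc (-(K : ℤ)) K), ‖latPt U fccVec b‖ < R → P (latPt U fccVec b)) :
    ∀ w ∈ {v : E3 | ∃ b : Fin 3 → ℤ, v = latPt U fccVec b}, ‖w‖ < R → P w := by
  rintro w ⟨b, rfl⟩ hwR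
  have h34 := norm_apply_ge_of_near_one hU (fccPoint b)
  rw [← latPt_fccVec_eq] at h34
  exact h b (mem_box_of_norm_fccPoint_lt hK (by linarith)) hwR

/-- ★ **hcp, A-type displacement set: a norm-bounded quantifier is two box conjunctions** (`‖U − 1‖ ≤ 1/4`, `‖ξ‖ ≤ 1/4`,
`64R² < 27(K+1)²`, `16(4R/3 + 1/4)² < 3(2K+1)²`). [folklore] -/
theorem forall_hcpA_of_forall_boxes {U : E3 →L[ℝ] E3} {ξ : E3} (hU : ‖U - 1‖ ≤ 1 / 4) (hξ : ‖ξ‖ ≤ 1 / 4) {R : ℝ} {K : ℕ}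
    (hK1 : 64 * R ^ 2 < 27 * ((K : ℝ) + 1) ^ 2) (hK2 : 16 * (4 / 3 * R + 1 / 4) ^ 2 < 3 * (2 * (K : ℝ) + 1) ^ 2) {P : E3 → Prop}
    (h1 : ∀ b ∈ (Fintype.piFinset fun _ : Fin 3 => Finset.Icc (-(K : ℤ)) K), ‖latPt U hexFrame b‖ < R → P (latPt U hexFrame b))
    (h2 : ∀ b ∈ (Fintype.piFinset fun _ : Fin 3 => Finset.Icc (-(K : ℤ)) K),
      ‖latPt U hexFrame b + U (hcpShift + ξ)‖ < R → P (latPt U hexFrame b + U (hcpShift + ξ))) :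
    ∀ w ∈ {v : E3 | ∃ b : Fin 3 → ℤ, v = latPt U hexFrame b ∨ v = latPt U hexFrame b + U (hcpShift + ξ)}, ‖w‖ < R → P w := by
  have hρ : 4 * (4 / 3 * R) ^ 2 < 3 * ((K : ℝ) + 1) ^ 2 := by nlinarith
  rintro w ⟨b, rfl | rfl⟩ hwR
  · have h34 := norm_apply_ge_of_near_one hU (latPt 1 hexFrame b)
    rw [← latPt_eq_apply_one] at h34
    exact h1 b (mem_box_of_norm_hexPt_lt' hρ (by linarith)) hwR
  · have h34 := norm_apply_ge_of_near_one hU (latPt 1 hexFrame b + hcpShift + ξ)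
    rw [← shifted_eq_apply] at h34
    have htri : ‖latPt 1 hexFrame b + hcpShift‖ ≤ ‖latPt 1 hexFrame b + hcpShift + ξ‖ + ‖ξ‖ := by
      calc ‖latPt 1 hexFrame b + hcpShift‖ = ‖(latPt 1 hexFrame b + hcpShift + ξ) - ξ‖ := by rw [add_sub_cancel_right]
        _ ≤ ‖latPt 1 hexFrame b + hcpShift + ξ‖ + ‖ξ‖ := norm_sub_le _ _
    exact h2 b (mem_box_of_norm_hexPt_add_shift_lt' hK2 (by linarith)) hwR

/-- ★ **hcp, B-type displacement set `T_B = −T_A`**: a (norm-symmetric) statement over `T_A` at `−w` gives it over `T_B`. [folklore] -/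
theorem forall_hcpB_of_forall_hcpA_neg {U : E3 →L[ℝ] E3} {ξ : E3} {R : ℝ} {P : E3 → Prop}
    (h : ∀ w ∈ {v : E3 | ∃ b : Fin 3 → ℤ, v = latPt U hexFrame b ∨ v = latPt U hexFrame b + U (hcpShift + ξ)}, ‖w‖ < R → P (-w)) :
    ∀ w ∈ {v : E3 | ∃ b : Fin 3 → ℤ, v = latPt U hexFrame b ∨ v = latPt U hexFrame b - U (hcpShift + ξ)}, ‖w‖ < R → P w := by
  intro w hw hwR
  have hneg : -w ∈ {v : E3 | ∃ b : Fin 3 → ℤ, v = latPt U hexFrame b ∨ v = latPt U hexFrame b + U (hcpShift + ξ)} := by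
    rw [hcpB_eq_neg_image_hcpA] at hw
    obtain ⟨w', hw', rfl⟩ := hw
    simpa using hw'
  simpa using h (-w) hneg (by rwa [norm_neg])

/-- Record instance, fcc, radius `15/2` (the prune lemmas' radius): box `[−12, 12]³` (`8·(15/2)² = 450 < 507 = 3·13²`). [folklore] -/
theorem forall_fcc_of_forall_box12 {U : E3 →L[ℝ] E3} (hU : ‖U - 1‖ ≤ 1 / 4) {P : E3 → Prop}
    (h : ∀ b ∈ (Fintype.piFinset fun _ : Fin 3 => Finset.Icc (-12 : ℤ) 12), ‖latPt U fccVec b‖ < 15 / 2 → P (latPt U fccVec b)) :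
    ∀ w ∈ {v : E3 | ∃ b : Fin 3 → ℤ, v = latPt U fccVec b}, ‖w‖ < 15 / 2 → P w := by
  have := forall_fcc_of_forall_box hU (R := 15 / 2) (K := 12) (by norm_num) (P := P) (by simpa using h)
  exact this

/-- Record instance, fcc, radius `5/2` (shortest-vector / radial-spread data): box `[−4, 4]³` (`8·(5/2)² = 50 < 75 = 3·5²`). [folklore] -/
theorem forall_fcc_of_forall_box4 {U : E3 →L[ℝ] E3} (hU : ‖U - 1‖ ≤ 1 / 4) {P : E3 → Prop}
    (h : ∀ b ∈ (Fintype.piFinset fun _ : Fin 3 => Finset.Icc (-4 : ℤ) 4), ‖latPt U fccVec b‖ < 5 / 2 → P (latPt U fccVec b)) :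
    ∀ w ∈ {v : E3 | ∃ b : Fin 3 → ℤ, v = latPt U fccVec b}, ‖w‖ < 5 / 2 → P w := by
  have := forall_fcc_of_forall_box hU (R := 5 / 2) (K := 4) (by norm_num) (P := P) (by simpa using h)
  exact this

end Summit.AtomisticToContinuum.Crystallization.Theorems.FrustratedLawDichotomyStrainedPatchHomBoxForall

end
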